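import Mathlib
import Literature.Probability.Moments.HoeffdingDecomposition
import Literature.Computability.Complexity.RandomKSatLowDegreeHardness

/-!
# Route OverlapGapAlgebra, crux `SearchHardWindow` (stmt-PneNP-2460): low coordinate degree ⇒
# average stability of the sign map (the stability budget of a low-degree algorithm)

Two deterministic counting lemmas about vector-valued functions `F : instances → ℝⁿ` on the
literal arrays `Fin m → Fin k → Fin n × Bool` of random `k`-SAT, in the vocabulary of the named fact
`HuangSellke2025KSat` (`IsCoordDegreeLE`, coordinate / Efron–Stein degree in the `m·k` literal
slots):

* `wld_hammingDist_le_sum_sq` — two SATURATED sign patterns (`|x_v| ≥ 1`) differ in at most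
  `‖x − x'‖²` coordinates;
* `wld_jumpCount_le` — if every output coordinate of `F` has coordinate degree `≤ D`, the number of
  (instance, slot, fresh literal) triples on which the sign map `Φ ↦ sgn F(Φ)` moves by more than
  `η n` in Hamming distance is at most `2n·(mk·#{Φ unsaturated}) + (4D/η)·Σ_Φ ‖F Φ‖²` — by the
  Hoeffding-decomposition bound "total `L²`-influence ≤ degree × energy"
  (`Literature.Probability.Moments.sum_sum_sum_sq_sub_update_le`, O'Donnell 2014 §8.3–8.4).

This is the "low degree polynomials are stable" half of Bresler–Huang 2021 (arXiv:2106.02129 §6,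
Prop. 6.x) in average (Markov) form; combined with the smooth-maps rung
(`OverlapGapAlgebraSearchHardWindowSmoothMapsFail.lean`) it yields weak low-degree hardness modulo
`NoStableSection` (`OverlapGapAlgebraSearchHardWindowWeakLowDegree.lean`).

References: G. Bresler, B. Huang, FOCS 2021 / arXiv:2106.02129, §6 [BreslerHuang2022];
R. O'Donnell, *Analysis of Boolean Functions*, CUP 2014, §8.3–8.4 [ODonnell2014].
-/

namespace Summit.PneNP.PneNP.Theorems

set_option linter.dupNamespace false -- `Summit.PneNP.PneNP.…`: summit = sub-problem (D-0017)

open Finset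
open Literature.Computability.Complexity (IsCoordDegreeLE)
open Literature.Probability.Moments
open scoped Classical

/-- Two SATURATED sign patterns differ in at most `‖x − x'‖²` coordinates: if every `|x v| ≥ 1`
then `d_H(sgn x, sgn x') ≤ Σ_v (x v − x' v)²` (a sign flip at a saturated coordinate costs at least
`1` in the difference). -/
theorem wld_hammingDist_le_sum_sq {n : ℕ} {x x' : Fin n → ℝ} (hx : ∀ v, 1 ≤ |x v|) :
    (hammingDist (fun v => decide (0 ≤ x v)) (fun v => decide (0 ≤ x' v)) : ℝ) ≤
      ∑ v, (x v - x' v) ^ 2 := by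
  rw [hammingDist]
  have hpt : ∀ v ∈ univ.filter (fun v : Fin n => decide (0 ≤ x v) ≠ decide (0 ≤ x' v)),
      (1 : ℝ) ≤ (x v - x' v) ^ 2 := by
    intro v hv
    rw [mem_filter] at hv
    have hne := hv.2
    have h1 := hx v
    have key : 1 ≤ |x v - x' v| := by
      by_cases h0 : 0 ≤ x v
      · have h0' : ¬ 0 ≤ x' v := fun h' => hne (by rw [decide_eq_true h0, decide_eq_true h'])
        rw [abs_of_nonneg h0] at h1
        rw [abs_of_nonneg (by linarith)]
        linarith
      · have h0' : 0 ≤ x' v := by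
          by_contra h'
          exact hne (by rw [decide_eq_false h0, decide_eq_false h'])
        rw [abs_of_neg (not_le.1 h0)] at h1
        rw [abs_of_nonpos (by linarith)]
        linarith
    nlinarith [abs_nonneg (x v - x' v), sq_abs (x v - x' v)]
  calc ((univ.filter fun v : Fin n => decide (0 ≤ x v) ≠ decide (0 ≤ x' v)).card : ℝ)
      = ∑ v ∈ univ.filter (fun v : Fin n => decide (0 ≤ x v) ≠ decide (0 ≤ x' v)), (1 : ℝ) := by
        simp
    _ ≤ ∑ v ∈ univ.filter (fun v : Fin n => decide (0 ≤ x v) ≠ decide (0 ≤ x' v)),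
          (x v - x' v) ^ 2 := sum_le_sum hpt
    _ ≤ ∑ v, (x v - x' v) ^ 2 :=
        sum_le_univ_sum_of_nonneg fun v => sq_nonneg _

/-- **Low coordinate degree ⇒ few large jumps of the sign map** (the stability budget). For
`F : instances → ℝⁿ` whose coordinates have coordinate degree `≤ D` in the `m·k` literal slots,
the number of (instance, slot, fresh literal) triples on which the sign map `Φ ↦ sgn F(Φ)` moves by
more than `η n` in Hamming distance is at most
`2n · (mk · #{Φ unsaturated}) + (4D/η) · Σ_Φ ‖F Φ‖²`:
unsaturated instances are given up, and on saturated ones a jump forces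
`‖F(Φ) − F(Φ')‖² > η n` (`wld_hammingDist_le_sum_sq`), whose total over all single-literal
resamplings is `≤ 2D·(2n)·Σ‖F‖²` by the Hoeffding-decomposition bound
`Literature.Probability.Moments.sum_sum_sum_sq_sub_update_le`. -/
theorem wld_jumpCount_le {m k n : ℕ} (hn : 1 ≤ n) {η : ℝ} (hη : 0 < η) {D : ℕ}
    (F : (Fin m → Fin k → Fin n × Bool) → Fin n → ℝ)
    (hdeg : ∀ v, IsCoordDegreeLE D (fun y : Fin m × Fin k → Fin n × Bool => F (Function.curry y) v)) :
    (∑ a : Fin m, ∑ b : Fin k,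
        (((Finset.univ : Finset ((Fin m → Fin k → Fin n × Bool) × (Fin n × Bool))).filter
          fun p => η * n < hammingDist (fun v => decide (0 ≤ F p.1 v))
            (fun v => decide (0 ≤ F (Function.update p.1 a (Function.update (p.1 a) b p.2)) v))).card
              : ℝ))
      ≤ 2 * n * ((m * k : ℕ) * ((Finset.univ.filter fun Φ : Fin m → Fin k → Fin n × Bool =>
            ¬ ∀ v, 1 ≤ |F Φ v|).card : ℝ)) +
        4 * D / η * ∑ Φ : Fin m → Fin k → Fin n × Bool, ∑ v, F Φ v ^ 2 := by
  haveI : Nonempty (Fin n × Bool) := ⟨(⟨0, hn⟩, true)⟩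
  have hn' : (0 : ℝ) < n := by exact_mod_cast hn
  have hηn : 0 < η * n := mul_pos hη hn'
  -- notation: the unsaturated count and the squared movement of `F` under one resampling
  set U : ℝ := ((Finset.univ.filter fun Φ : Fin m → Fin k → Fin n × Bool =>
    ¬ ∀ v, 1 ≤ |F Φ v|).card : ℝ) with hU
  set f : Fin m → Fin k → (Fin m → Fin k → Fin n × Bool) × (Fin n × Bool) → Fin n → ℝ :=
    fun a b p v => (F p.1 v - F (Function.update p.1 a (Function.update (p.1 a) b p.2)) v) ^ 2
    with hf
  -- (1) per slot: indicator ≤ [unsaturated] + movement/(η n), summed over (instance, literal)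
  have hslot : ∀ (a : Fin m) (b : Fin k),
      (((Finset.univ : Finset ((Fin m → Fin k → Fin n × Bool) × (Fin n × Bool))).filter
          fun p => η * n < hammingDist (fun v => decide (0 ≤ F p.1 v))
            (fun v => decide (0 ≤ F (Function.update p.1 a (Function.update (p.1 a) b p.2)) v))).card
              : ℝ)
        ≤ 2 * n * U + (η * n)⁻¹ * ∑ p, ∑ v, f a b p v := by
    intro a b
    rw [Finset.card_filter, Nat.cast_sum]
    have hpt : ∀ p : (Fin m → Fin k → Fin n × Bool) × (Fin n × Bool),
        ((if η * n < hammingDist (fun v => decide (0 ≤ F p.1 v))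
            (fun v => decide (0 ≤ F (Function.update p.1 a (Function.update (p.1 a) b p.2)) v))
          then 1 else 0 : ℕ) : ℝ)
          ≤ (if ¬ ∀ v, 1 ≤ |F p.1 v| then 1 else 0 : ℝ) + (η * n)⁻¹ * ∑ v, f a b p v := by
      intro p
      have hΔ0 : 0 ≤ (η * n)⁻¹ * ∑ v, f a b p v :=
        mul_nonneg (inv_nonneg.2 hηn.le) (sum_nonneg fun v _ => by rw [hf]; exact sq_nonneg _)
      by_cases hsat : ∀ v, 1 ≤ |F p.1 v|
      · rw [if_neg (not_not.2 hsat), zero_add]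
        split_ifs with hj
        · have hd := wld_hammingDist_le_sum_sq
            (x' := fun v => F (Function.update p.1 a (Function.update (p.1 a) b p.2)) v) hsat
          have h1 : η * n < ∑ v, f a b p v := lt_of_lt_of_le hj hd
          push_cast
          calc (1 : ℝ) = (η * n)⁻¹ * (η * n) := by rw [inv_mul_cancel₀ hηn.ne']
            _ ≤ (η * n)⁻¹ * ∑ v, f a b p v :=
                mul_le_mul_of_nonneg_left h1.le (inv_nonneg.2 hηn.le)
        · push_cast; exact hΔ0
      · rw [if_pos hsat]
        split_ifs <;> push_cast <;> linarith
    refine (sum_le_sum fun p _ => hpt p).trans (le_of_eq ?_)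
    rw [sum_add_distrib, ← mul_sum]
    congr 1
    calc ∑ p : (Fin m → Fin k → Fin n × Bool) × (Fin n × Bool),
          (if ¬ ∀ v, 1 ≤ |F p.1 v| then (1 : ℝ) else 0)
        = ∑ Φ : Fin m → Fin k → Fin n × Bool, ∑ _ℓ : Fin n × Bool,
            (if ¬ ∀ v, 1 ≤ |F Φ v| then (1 : ℝ) else 0) := Fintype.sum_prod_type _
      _ = ∑ Φ : Fin m → Fin k → Fin n × Bool,
            (Fintype.card (Fin n × Bool) : ℝ) * (if ¬ ∀ v, 1 ≤ |F Φ v| then (1 : ℝ) else 0) := by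
          simp only [sum_const, card_univ, nsmul_eq_mul]
      _ = 2 * n * U := by
          rw [← mul_sum, sum_boole, hU, Fintype.card_prod, Fintype.card_fin, Fintype.card_bool]
          push_cast; ring
  -- (2) the Hoeffding bound on the total squared movement, per output coordinate `v`
  have hcurry : ∀ (G : (Fin m → Fin k → Fin n × Bool) → ℝ),
      ∑ Φ, G Φ = ∑ y : Fin m × Fin k → Fin n × Bool, G (Function.curry y) := fun G =>
    (Fintype.sum_equiv (Equiv.curry _ _ _) _ _ fun _ => rfl).symm
  have hv : ∀ v : Fin n, ∑ a : Fin m, ∑ b : Fin k, ∑ Φ : Fin m → Fin k → Fin n × Bool,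
      ∑ ℓ : Fin n × Bool, (F Φ v - F (Function.update Φ a (Function.update (Φ a) b ℓ)) v) ^ 2 ≤
        2 * D * (2 * n) * ∑ Φ : Fin m → Fin k → Fin n × Bool, F Φ v ^ 2 := by
    intro v
    have h := sum_sum_sum_sq_sub_update_le (hdeg v)
    rw [Fintype.sum_prod_type] at h
    simp only [Function.curry_update] at h
    have e1 : ∀ (a : Fin m) (b : Fin k), ∑ y : Fin m × Fin k → Fin n × Bool, ∑ ℓ : Fin n × Bool,
        (F (Function.curry y) v -
          F (Function.update (Function.curry y) a (Function.update (Function.curry y a) b ℓ)) v) ^ 2 =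
        ∑ Φ : Fin m → Fin k → Fin n × Bool, ∑ ℓ : Fin n × Bool,
          (F Φ v - F (Function.update Φ a (Function.update (Φ a) b ℓ)) v) ^ 2 := fun a b =>
      (hcurry fun Φ => ∑ ℓ : Fin n × Bool,
        (F Φ v - F (Function.update Φ a (Function.update (Φ a) b ℓ)) v) ^ 2).symm
    have e2 : ∑ y : Fin m × Fin k → Fin n × Bool, F (Function.curry y) v ^ 2 =
        ∑ Φ : Fin m → Fin k → Fin n × Bool, F Φ v ^ 2 := (hcurry fun Φ => F Φ v ^ 2).symm
    simp only [e1, e2, Fintype.card_prod, Fintype.card_fin, Fintype.card_bool] at h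
    push_cast at h
    linarith
  have hhoef : ∑ a : Fin m, ∑ b : Fin k, ∑ p, ∑ v, f a b p v ≤
      2 * D * (2 * n) * ∑ Φ : Fin m → Fin k → Fin n × Bool, ∑ v, F Φ v ^ 2 := by
    -- bring `v` outside, split `p = (Φ, ℓ)`, apply `hv`, re-sum
    calc ∑ a : Fin m, ∑ b : Fin k, ∑ p, ∑ v, f a b p v
        = ∑ a : Fin m, ∑ b : Fin k, ∑ v, ∑ p, f a b p v :=
          sum_congr rfl fun a _ => sum_congr rfl fun b _ => sum_comm
      _ = ∑ a : Fin m, ∑ v, ∑ b : Fin k, ∑ p, f a b p v := sum_congr rfl fun a _ => sum_comm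
      _ = ∑ v, ∑ a : Fin m, ∑ b : Fin k, ∑ p, f a b p v := sum_comm
      _ = ∑ v, ∑ a : Fin m, ∑ b : Fin k, ∑ Φ : Fin m → Fin k → Fin n × Bool,
            ∑ ℓ : Fin n × Bool, (F Φ v - F (Function.update Φ a (Function.update (Φ a) b ℓ)) v) ^ 2 := by
          simp only [hf, Fintype.sum_prod_type (f := fun p : (Fin m → Fin k → Fin n × Bool) ×
            (Fin n × Bool) => _)]
      _ ≤ ∑ v, 2 * D * (2 * n) * ∑ Φ : Fin m → Fin k → Fin n × Bool, F Φ v ^ 2 :=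
          sum_le_sum fun v _ => hv v
      _ = 2 * D * (2 * n) * ∑ Φ : Fin m → Fin k → Fin n × Bool, ∑ v, F Φ v ^ 2 := by
          rw [← mul_sum, sum_comm]
  -- (3) assemble
  calc _ ≤ ∑ a : Fin m, ∑ b : Fin k, (2 * n * U + (η * n)⁻¹ * ∑ p, ∑ v, f a b p v) :=
        sum_le_sum fun a _ => sum_le_sum fun b _ => hslot a b
    _ = 2 * n * ((m * k : ℕ) * U) + (η * n)⁻¹ * ∑ a : Fin m, ∑ b : Fin k, ∑ p, ∑ v, f a b p v := by
        simp only [sum_add_distrib, sum_const, card_univ, Fintype.card_fin, nsmul_eq_mul, ← mul_sum]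
        push_cast; ring
    _ ≤ 2 * n * ((m * k : ℕ) * U) + (η * n)⁻¹ * (2 * D * (2 * n) * ∑ Φ, ∑ v, F Φ v ^ 2) := by
        gcongr
    _ = 2 * n * ((m * k : ℕ) * U) + 4 * D / η * ∑ Φ, ∑ v, F Φ v ^ 2 := by
        field_simp
        ring

end Summit.PneNP.PneNP.Theorems
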